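import Literature.NumberTheory.Automorphic.CMPrincipalSeriesTraceTorusForm
import Literature.NumberTheory.Automorphic.QuadraticLocalBaseChange
import Literature.NumberTheory.Automorphic.CMLocalNonsplitBorelTransport
import Mathlib.Topology.Algebra.Valued.WithZeroMulInt
import HarnessLib

/-!
# Preliminaries for «non-regular torus elements are Haar-null»: Steinhaus for subgroups, the closed diagonal torus, and a sequence of
# `σ`-fixed units `U_k → 1` of `∏_{w ∣ v} L_w` off the walls (Rogawski 1990 §1.10, §4.9)

Topic `NumberTheory/Automorphic`; namespaces `Literature.NumberTheory.Automorphic` (§1, generic) and `….UnitaryGroup` (§2–§4, the CM torus).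
THEOREMS ONLY (no definition, no instance, no notation, no named fact, no `sorry`).  Cell `pub/hodgecm-mathlib`, line «CMCharIdentityTest» (F0P3b
`Cruxes/H413/Lines/F0_P3b_CMCharIdentityTestPaydown.lean` ED. 11), desk F0P3b-plan (g12) FORWARD DEAL 07:31:16Z S-lemma **(L1)** of the (N-492) road
[Rogawski1990 Lemma 4.9.2]: S1 ★ `exists_smoothTrace_cmPrincipalSeries_eq_integral_torus` integrates over ALL of `T`, while the torus descent (S0 ∕ ★
`lintegral_descConj_torusU_cmLocal_regular_eq_mul_lintegral_prod`) holds at `T`-REGULAR `t = diag(d)` only (`d₀⁻¹d₁ − 1`, `d₀⁻¹d₂ − 1` units of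
`∏_{w ∣ v} L_w`); the sequel proves that the complement is null for every Haar measure `μ_T` on the torus; this file carries the three generic ingredients.
* §1 (generic Steinhaus) `measure_subgroup_eq_zero_of_not_mem_nhds` — a measurable subgroup `H` of a locally compact group that is not a neighbourhood of `1`
  is null for an (inner regular) Haar measure (Mathlib `div_mem_nhds_one_of_haar_pos`, `H ∕ H = H`); `measure_subgroup_eq_zero_of_tendsto` — the same
  from a net `u → 1` frequently outside `H`.
* §2 (generic torus, any `N`, `T₁` ring) `isClosed_torusU_of_t1Space`; `continuous_coe_torusEntry_apply` (the coordinates `t ↦ t_ii` and `t ↦ (t⁻¹)_ii`).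
* §3 (CM, any `N`) `exists_units_tendsto_one_conjLocal_eq` — a sequence of `σ`-FIXED units `U_k → 1` of `∏_{w ∣ v} L_w` (`U_k = 1 + ι_v(ϖ^{k+1})`, `ϖ` a
  uniformiser of `L⁺_v`: ★ `toLocalRing`, ★ `conjLocal_toLocalRing`, Mathlib `Valued.tendsto_zero_pow_of_v_lt_one`) with `(U_k)_w ≠ 1` for all `k, w` and
  `(U_k)_w² ≠ 1` eventually.
The consumer is the sequel `CMTorusRegularAE` (`ae_isUnit_torusRatio_sub_one_three ∕ _two`).
HONEST LABEL: HC_CM is proved only modulo the printed citations (2 remaining named inputs hLiu418, h413) until rung 0 closes; this file pays no letter by itself.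

## References
* [Rogawski1990] J. D. Rogawski, *Automorphic Representations of Unitary Groups in Three Variables* (1990), §1.10 p. 9, §4.9 p. 55, §12.5 p. 183.
* [Folland1995] G. B. Folland, *A Course in Abstract Harmonic Analysis* (1995), Prop. 2.4, (2.32) (Steinhaus).
* [HarishChandra1970] Harish-Chandra, *Harmonic analysis on reductive p-adic groups*, LNM 162 (1970), §§3–5 (regular set of full measure).
-/

set_option autoImplicit false

noncomputable section

open NumberField IsDedekindDomain MeasureTheory MeasureTheory.Measure Topology Filter
open scoped MatrixGroups

namespace Literature.NumberTheory.Automorphic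

/-! ## §1 Steinhaus: a subgroup that is not a neighbourhood of `1` is Haar-null -/

section Steinhaus

variable {G : Type*} [Group G] [TopologicalSpace G] [IsTopologicalGroup G] [LocallyCompactSpace G] [MeasurableSpace G] [BorelSpace G]
  (μ : Measure G) [μ.IsHaarMeasure] [μ.InnerRegular]

/-- **A measurable subgroup that is not a neighbourhood of `1` is Haar-null**: if `μ H > 0` then `H = H ∕ H` is a neighbourhood of `1` (Steinhaus, Mathlib
`div_mem_nhds_one_of_haar_pos`). [cite: Folland1995, Prop. 2.4] -/
theorem measure_subgroup_eq_zero_of_not_mem_nhds (H : Subgroup G) (hHm : MeasurableSet (H : Set G)) (hH : (H : Set G) ∉ 𝓝 (1 : G)) :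
    μ H = 0 := by
  by_contra hne
  apply hH
  have hdiv := div_mem_nhds_one_of_haar_pos μ (H : Set G) hHm (pos_iff_ne_zero.2 hne)
  refine Filter.mem_of_superset hdiv ?_
  rintro _ ⟨a, ha, b, hb, rfl⟩
  exact H.div_mem ha hb

/-- **A measurable subgroup avoided frequently by a net `u → 1` is Haar-null** (`measure_subgroup_eq_zero_of_not_mem_nhds`). [cite: Folland1995, Prop. 2.4] -/
theorem measure_subgroup_eq_zero_of_tendsto (H : Subgroup G) (hHm : MeasurableSet (H : Set G)) {ι : Type*} {l : Filter ι}
    {u : ι → G} (hu : Tendsto u l (𝓝 1)) (huH : ∃ᶠ k in l, u k ∉ H) : μ H = 0 := by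
  refine measure_subgroup_eq_zero_of_not_mem_nhds μ H hHm fun hmem => ?_
  obtain ⟨k, hk1, hk2⟩ := (huH.and_eventually (hu.eventually_mem hmem)).exists
  exact hk1 hk2

end Steinhaus

/-! ## §2 The diagonal torus of `U(σ, J)(R)`: closedness and continuity of the coordinates (any `N`) -/

namespace UnitaryGroup

section Torus

variable {R : Type*} [CommRing R] [TopologicalSpace R] [IsTopologicalRing R] (σ : R →+* R) {N : ℕ} (J : Matrix (Fin N) (Fin N) R)

omit [IsTopologicalRing R] in
/-- **`T` is closed in `U(σ, J)(R)`** for a `T₁` topological ring `R` (the vanishing of the continuous off-diagonal entries; ★ `mem_range_glDiagonal_iff_isDiag`).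
[cite: Rogawski1990, §1.10 p. 9] -/
theorem isClosed_torusU_of_t1Space [T1Space R] : IsClosed (torusU σ J : Set ↥(unitaryGroupOfForm σ J)) := by
  have hcont : ∀ i j : Fin N, Continuous fun g : ↥(unitaryGroupOfForm σ J) => ((g : GL (Fin N) R) : Matrix (Fin N) (Fin N) R) i j := fun i j =>
    (Units.continuous_val.comp continuous_subtype_val).matrix_elem i j
  have hset : (torusU σ J : Set ↥(unitaryGroupOfForm σ J)) =
      ⋂ i : Fin N, ⋂ j : Fin N, {g : ↥(unitaryGroupOfForm σ J) | i ≠ j → ((g : GL (Fin N) R) : Matrix (Fin N) (Fin N) R) i j = 0} := by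
    ext g
    simp only [Set.mem_iInter, Set.mem_setOf_eq, SetLike.mem_coe]
    exact (mem_range_glDiagonal_iff_isDiag (g : GL (Fin N) R)).trans ⟨fun h i j hij => h hij, fun h i j hij => h i j hij⟩
  rw [hset]
  refine isClosed_iInter fun i => isClosed_iInter fun j => ?_
  by_cases hij : i ≠ j
  · have : {g : ↥(unitaryGroupOfForm σ J) | i ≠ j → ((g : GL (Fin N) R) : Matrix (Fin N) (Fin N) R) i j = 0} =
        (fun g : ↥(unitaryGroupOfForm σ J) => ((g : GL (Fin N) R) : Matrix (Fin N) (Fin N) R) i j) ⁻¹' {0} := by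
      ext g; simp [hij]
    rw [this]
    exact isClosed_singleton.preimage (hcont i j)
  · have : {g : ↥(unitaryGroupOfForm σ J) | i ≠ j → ((g : GL (Fin N) R) : Matrix (Fin N) (Fin N) R) i j = 0} = Set.univ := by
      ext g; simp [hij]
    rw [this]
    exact isClosed_univ

omit [IsTopologicalRing R] in
/-- The coordinate `t ↦ t_ii ∈ R` is continuous on `T`. [cite: Rogawski1990, §1.10 p. 9] -/
theorem continuous_coe_torusEntry_apply (i : Fin N) : Continuous fun t : ↥(torusU σ J) => ((torusEntry σ J i t : Rˣ) : R) := by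
  simp only [coe_torusEntry]
  exact ((Units.continuous_val.comp continuous_subtype_val).comp continuous_subtype_val).matrix_elem i i

/-- The coordinate ratio `t ↦ d₀⁻¹ dᵢ ∈ R` is continuous on `T` (`(d₀ t)⁻¹ = d₀(t⁻¹)`). [cite: Rogawski1990, §1.10 p. 9] -/
theorem continuous_coe_torusEntry_inv_mul (i j : Fin N) :
    Continuous fun t : ↥(torusU σ J) => (((torusEntry σ J i t)⁻¹ * torusEntry σ J j t : Rˣ) : R) := by
  have h : ∀ t : ↥(torusU σ J), (((torusEntry σ J i t)⁻¹ * torusEntry σ J j t : Rˣ) : R) =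
      ((torusEntry σ J i t⁻¹ : Rˣ) : R) * ((torusEntry σ J j t : Rˣ) : R) := fun t => by
    rw [Units.val_mul, map_inv]
  simp only [h]
  exact ((continuous_coe_torusEntry_apply σ J i).comp continuous_inv).mul (continuous_coe_torusEntry_apply σ J j)

end Torus

/-! ## §3 A sequence of `σ`-fixed units `U_k → 1` of `∏_{w ∣ v} L_w` off the walls -/

section Units

variable (L : Type) [Field L] [NumberField L] [IsCMField L] (v : HeightOneSpectrum (𝓞 ↥(maximalRealSubfield L)))

/-- **A sequence of `σ`-fixed units `U_k → 1` of `∏_{w ∣ v} L_w` with `(U_k)_w ≠ 1` always and `(U_k)_w² ≠ 1` eventually**: `U_k = 1 + ι_v(ϖ^{k+1})` for `ϖ ∈ L⁺` a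
uniformiser at `v` (Mathlib `valuation_exists_uniformizer`, `Valued.tendsto_zero_pow_of_v_lt_one`; `ι_v` = ★ `toLocalRing`, fixed by `σ = c ⊗ 1`, ★
`conjLocal_toLocalRing`; `(U_k)_w² = 1 ⟺ ι_w(ϖ^{k+1}) ∈ {0, −2}`). [cite: Rogawski1990, §1.10 p. 9] [folklore] -/
theorem exists_units_tendsto_one_conjLocal_eq :
    ∃ U : ℕ → (LocalRing L v)ˣ,
      (∀ k, conjLocal L (IsCMField.complexConj L) v (U k : LocalRing L v) = U k) ∧
      Tendsto (fun k => (U k : LocalRing L v)) atTop (𝓝 1) ∧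
      Tendsto (fun k => (((U k)⁻¹ : (LocalRing L v)ˣ) : LocalRing L v)) atTop (𝓝 1) ∧
      (∀ k (w : PlacesOver L v), (U k : LocalRing L v) w ≠ 1) ∧
      (∀ᶠ k in atTop, ∀ w : PlacesOver L v, (U k : LocalRing L v) w * (U k : LocalRing L v) w ≠ 1) := by
  obtain ⟨π, hπ⟩ := v.valuation_exists_uniformizer ↥(maximalRealSubfield L)
  -- the sequence `y k = ϖ^{k+1} → 0` in `L⁺_v`, never `0`, eventually `≠ -2`
  set y : ℕ → v.adicCompletion ↥(maximalRealSubfield L) := fun k => ((π : v.adicCompletion ↥(maximalRealSubfield L))) ^ (k + 1) with hy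
  have hπv : Valued.v (π : v.adicCompletion ↥(maximalRealSubfield L)) < 1 := by
    rw [HeightOneSpectrum.valuedAdicCompletion_eq_valuation', hπ, ← WithZero.exp_zero, WithZero.exp_lt_exp]
    norm_num
  have hπ0 : (π : v.adicCompletion ↥(maximalRealSubfield L)) ≠ 0 := by
    intro h
    have : Valued.v (π : v.adicCompletion ↥(maximalRealSubfield L)) = 0 := by rw [h, map_zero]
    rw [HeightOneSpectrum.valuedAdicCompletion_eq_valuation', hπ] at this
    exact WithZero.coe_ne_zero this
  have hy0 : Tendsto y atTop (𝓝 0) :=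
    (Valued.tendsto_zero_pow_of_v_lt_one hπv).comp (tendsto_add_atTop_nat 1)
  have hyne : ∀ k, y k ≠ 0 := fun k => pow_ne_zero _ hπ0
  have hyv : ∀ k, Valued.v (y k) < 1 := fun k => by
    rw [hy, map_pow]
    exact pow_lt_one₀ zero_le hπv (Nat.succ_ne_zero k)
  have hy1 : ∀ k, (1 : v.adicCompletion ↥(maximalRealSubfield L)) + y k ≠ 0 := fun k => by
    intro h
    have h1 : Valued.v ((1 : v.adicCompletion ↥(maximalRealSubfield L)) + y k) = 1 := by
      rw [Valuation.map_add_eq_of_lt_left]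
      · exact Valuation.map_one _
      · rw [Valuation.map_one]; exact hyv k
    rw [h, map_zero] at h1
    exact zero_ne_one h1
  have hy2 : ∀ᶠ k in atTop, y k ≠ -2 := by
    refine hy0.eventually_ne ?_
    intro h
    have h2 : ((-2 : ↥(maximalRealSubfield L)) : v.adicCompletion ↥(maximalRealSubfield L)) = 0 := by
      rw [show ((-2 : ↥(maximalRealSubfield L)) : v.adicCompletion ↥(maximalRealSubfield L)) =
        algebraMap ↥(maximalRealSubfield L) (v.adicCompletion ↥(maximalRealSubfield L)) (-2) from rfl, map_neg, map_ofNat]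
      exact h.symm
    have h3 : (-2 : ↥(maximalRealSubfield L)) = 0 :=
      (algebraMap ↥(maximalRealSubfield L) (v.adicCompletion ↥(maximalRealSubfield L))).injective
        (by rw [map_zero]; exact h2)
    norm_num at h3
  -- the units `U k = 1 + ι_v(y k)`
  set Uv : ℕ → LocalRing L v := fun k => 1 + toLocalRing L v (y k) with hUv
  have hUw : ∀ k (w : PlacesOver L v), Uv k w = 1 + toPlace v w (y k) := fun k w => by
    simp only [hUv, Pi.add_apply, Pi.one_apply, toLocalRing_apply]
  have hUw' : ∀ k (w : PlacesOver L v), Uv k w = toPlace v w (1 + y k) := fun k w => by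
    rw [hUw, map_add, map_one]
  have hUne : ∀ k (w : PlacesOver L v), Uv k w ≠ 0 := fun k w => by
    rw [hUw']
    exact (map_ne_zero (toPlace v w)).2 (hy1 k)
  set U : ℕ → (LocalRing L v)ˣ := fun k =>
    ⟨Uv k, fun w => (Uv k w)⁻¹, funext fun w => mul_inv_cancel₀ (hUne k w), funext fun w => inv_mul_cancel₀ (hUne k w)⟩ with hU
  have hUval : ∀ k, (U k : LocalRing L v) = Uv k := fun _ => rfl
  have hUinv : ∀ k, (((U k)⁻¹ : (LocalRing L v)ˣ) : LocalRing L v) = fun w => (Uv k w)⁻¹ := fun _ => rfl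
  refine ⟨U, fun k => ?_, ?_, ?_, fun k w => ?_, ?_⟩
  · -- `σ`-fixed
    rw [hUval, hUv]
    simp only [map_add, map_one, conjLocal_toLocalRing]
  · -- `U k → 1`
    have h := ((continuous_toLocalRing L v).tendsto 0).comp hy0
    rw [map_zero] at h
    have h' := h.const_add (1 : LocalRing L v)
    simp only [add_zero] at h'
    exact h'
  · -- `(U k)⁻¹ → 1`
    simp only [hUinv]
    refine tendsto_pi_nhds.2 fun w => ?_
    have h := ((continuous_toPlace v w).tendsto 0).comp hy0
    rw [map_zero] at h
    have h' := (h.const_add (1 : w.1.adicCompletion L)).inv₀ (by rw [add_zero]; exact one_ne_zero)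
    simp only [add_zero, inv_one] at h'
    refine h'.congr fun k => ?_
    simp only [Function.comp_apply, hUw k w]
  · -- `(U k)_w ≠ 1`
    rw [hUval, hUw]
    intro h
    have h0 : toPlace v w (y k) = 0 := by
      have := congrArg (fun x => x - 1) h
      simpa using this
    exact hyne k ((map_eq_zero (toPlace v w)).1 h0)
  · -- `(U k)_w² ≠ 1` eventually
    filter_upwards [hy2] with k hk w
    rw [hUval, hUw]
    intro h
    rcases mul_self_eq_one_iff.1 h with h1 | h1
    · have h0 : toPlace v w (y k) = 0 := by
        have := congrArg (fun x => x - 1) h1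
        simpa using this
      exact hyne k ((map_eq_zero (toPlace v w)).1 h0)
    · have h0 : toPlace v w (y k) = toPlace v w (-2) := by
        rw [map_neg, map_ofNat]
        have := congrArg (fun x => x - 1) h1
        simp only [add_sub_cancel_left] at this
        rw [this]; norm_num
      exact hk ((toPlace v w).injective h0)

end Units

end UnitaryGroup

end Literature.NumberTheory.Automorphic

end
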